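import Mathlib
import Summits.Ventures.PercRepro2.Defs
import Summits.Ventures.PercRepro2.Independence
import Summits.Ventures.PercRepro2.Harris
import Summits.Ventures.PercRepro2.Graph
import Summits.Ventures.PercRepro2.Exploration
import Summits.Ventures.PercRepro2.Events
import Summits.Ventures.PercRepro2.Induced

/-!
# Row 2′CON-W: the rung is stable under contracting a vertex set — (CON-W) / (CCT-W)
(blind cell PercRepro2, typer-1; mine-c g6 MINE-C.md v3.0 §13, INBOX 2026-08-23T16:00:55Z; lead g11
16:01:29Z "row 2′CON-W FILED as CANDIDATE … typer-1: (CON-W) Prop (contraction of W as a graph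
operation on `ends`)")

**Contraction as a graph operation on `ends`.** For `W : Finset V` with a representative `w₀ ∈ W`,
`contractMap W w₀` sends every vertex of `W` to `w₀` and fixes the others, and
`contractEnds ends W w₀ e = (ends e).map (contractMap W w₀)` is the graph `H/W` on the SAME vertex
type and the SAME edge type (edges inside `W` become loops, which `openGraph` ignores; the vertices
of `W ∖ {w₀}` become isolated). So the events of `H/W` are ordinary events of the configuration
space, and `Conn (contractEnds ends W w₀) ω s t` is literally "`s ↝ t` in `H/W`".

* `conn_contract_of_conn`: an `H`-connection maps to an `H/W`-connection of the images;
* **`conn_contract_iff`** (mine-c's identity "`{s ↛_{H/W} T} = R_T ∖ {S hits W ∧ hull(T) hits W}`"):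
  for `s, t ∉ W`, `s ↝_{H/W} t ↔ s ↔_H t ∨ (C_H(s) hits W ∧ C_H(t) hits W)`;
* `avoidAll_contract_subset`: `s ↛_{H/W} T ⊆ s ↮_H T` (`s ∉ W`, `T ∩ W = ∅`).

**The rows** (root `s`, avoided `T`, markers `a, b`, `W ⊆ V ∖ (T ∪ {s})`, `H`-events
`X = {a ∈ C_H(s)}`, `H`-centring `m = E_H[· | R_T]`, all cleared by `P(R_T)²`):

* **`ConW`** `E_H[(X − m_X)(Y − m_Y); s ↛_{H/W} T] ≥ 0`:
  `P(R_T)² P(XY; R′) − P(R_T)[P(X; R_T) P(Y; R′) + P(Y; R_T) P(X; R′)] + P(X; R_T) P(Y; R_T) P(R′) ≥ 0`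
  with `R′ = {s ↛_{H/W} T}`;
* **`CCTW`**: the same with the merged events `X_{H/W} = {a ∈ C_{H/W}(s)}` inside the `R′`-terms.

`|W| = 2` (with `W` the ends of a virtual edge `e`) is (CC-T⁻) resp. (CC-T) for `H + e` at `e`
(the rows of record); `|W| ≥ 3` is new. Census (mine-c, own code, every negative re-checked exactly):
`n = 6` ALL 112 graphs × 12 vectors, every root, `|T| ≤ 2`, every `W`, every pair — `|W| = 2`
0 / 2,177,280, `|W| = 3` 0 / 1,209,600, `|W| = 4` 0 / 241,920; `n = 7` ALL 853 graphs × 3 vectors —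
`|W| = 2` 0 / 20,420,820, `|W| = 3` 0 / 17,196,480; (CCT-W) 0 on every scope; minima exact ties.
One implementation (engine twin = queue item 14).
-/

namespace Summit.Ventures.PercRepro2

namespace Contract

variable {V : Type*} {E : Type*}

/-! ## The contraction -/

section Map

variable [DecidableEq V]

/-- The contraction map: every vertex of `W` goes to the representative `w₀`, the others stay. -/
def contractMap (W : Finset V) (w₀ : V) (v : V) : V := if v ∈ W then w₀ else v

/-- `H/W` as a graph on the same vertex and edge types: `e` joins the images of its ends. -/
def contractEnds (ends : E → Sym2 V) (W : Finset V) (w₀ : V) : E → Sym2 V :=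
  fun e => (ends e).map (contractMap W w₀)

variable {W : Finset V} {w₀ : V}

/-- A vertex of `W` goes to `w₀`. -/
lemma contractMap_of_mem {v : V} (hv : v ∈ W) : contractMap W w₀ v = w₀ := by
  simp [contractMap, hv]

/-- A vertex outside `W` is fixed. -/
lemma contractMap_of_notMem {v : V} (hv : v ∉ W) : contractMap W w₀ v = v := by
  simp [contractMap, hv]

/-- The image of the contraction map lies in `(V ∖ W) ∪ {w₀}`. -/
lemma contractMap_mem_or (v : V) : contractMap W w₀ v = w₀ ∨ contractMap W w₀ v ∉ W := by
  by_cases hv : v ∈ W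
  · exact Or.inl (contractMap_of_mem hv)
  · rw [contractMap_of_notMem hv]; exact Or.inr hv

/-- The ends of `e` in `H/W`. -/
lemma contractEnds_apply (ends : E → Sym2 V) (e : E) :
    contractEnds ends W w₀ e = (ends e).map (contractMap W w₀) := rfl

/-- Contracting a subset of `{w₀}` changes nothing. -/
lemma contractEnds_of_subset_singleton (ends : E → Sym2 V) (hW : W ⊆ {w₀}) :
    contractEnds ends W w₀ = ends := by
  funext e
  rw [contractEnds_apply]
  have hid : contractMap W w₀ = id := by
    funext v
    by_cases hv : v ∈ W
    · rw [contractMap_of_mem hv]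
      exact (Finset.mem_singleton.1 (hW hv)).symm
    · exact contractMap_of_notMem hv
  rw [hid, Sym2.map_id]
  rfl

end Map

/-! ## Connections in the contracted graph -/

section Conn

variable [DecidableEq V] {ends : E → Sym2 V} {W : Finset V} {w₀ : V} {ω : Config E}

/-- An open edge of `H` with ends `{x, y}` is an open edge of `H/W` with ends `{π x, π y}`. -/
lemma openAdj_contract_of_openAdj {x y : V} (h : OpenAdj ends ω x y) :
    OpenAdj (contractEnds ends W w₀) ω (contractMap W w₀ x) (contractMap W w₀ y) := by
  obtain ⟨e, he, hends⟩ := h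
  exact ⟨e, he, by rw [contractEnds_apply, hends, Sym2.map_mk]⟩

/-- An `H`-connection maps to an `H/W`-connection between the images. -/
lemma conn_contract_of_conn {x y : V} (h : Conn ends ω x y) :
    Conn (contractEnds ends W w₀) ω (contractMap W w₀ x) (contractMap W w₀ y) := by
  let S : Set V := {z | Conn (contractEnds ends W w₀) ω (contractMap W w₀ x) (contractMap W w₀ z)}
  have hS : ∀ z ∈ S, ∀ z', (openGraph ends ω).Adj z z' → z' ∈ S := by
    intro z hz z' hzz'
    obtain ⟨_, hadj⟩ := openGraph_adj.1 hzz'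
    exact conn_trans hz (conn_of_openAdj (openAdj_contract_of_openAdj hadj))
  exact mem_of_conn_of_closed hS (conn_refl _ _ _) h

/-- `C_H(s)` hits `W` and `C_H(t)` hits `W` ⟹ `s ↝ t` in `H/W`. -/
lemma conn_contract_of_hits {s t : V} (hs : ∃ w ∈ W, Conn ends ω s w)
    (ht : ∃ w ∈ W, Conn ends ω w t) :
    Conn (contractEnds ends W w₀) ω (contractMap W w₀ s) (contractMap W w₀ t) := by
  obtain ⟨w₁, hw₁, hs₁⟩ := hs
  obtain ⟨w₂, hw₂, ht₂⟩ := ht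
  have h1 := conn_contract_of_conn (W := W) (w₀ := w₀) hs₁
  have h2 := conn_contract_of_conn (W := W) (w₀ := w₀) ht₂
  rw [contractMap_of_mem hw₁] at h1
  rw [contractMap_of_mem hw₂] at h2
  exact conn_trans h1 h2

/-- **Connections in `H/W`** (mine-c §13): for `s, t ∉ W`,
`s ↝_{H/W} t ↔ s ↔_H t ∨ (C_H(s) hits W ∧ C_H(t) hits W)`. -/
theorem conn_contract_iff (hw₀ : w₀ ∈ W) {s t : V} (hs : s ∉ W) (ht : t ∉ W) :
    Conn (contractEnds ends W w₀) ω s t ↔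
      Conn ends ω s t ∨ ((∃ w ∈ W, Conn ends ω s w) ∧ ∃ w ∈ W, Conn ends ω w t) := by
  constructor
  · intro h
    -- the closed set: `H`-reachable from `s`, or reached through `W`
    let S : Set V := {z | Conn ends ω s z ∨ ((∃ w ∈ W, Conn ends ω s w) ∧ ∃ w ∈ W, Conn ends ω w z)}
    -- one open `H`-edge `{y, y'}` moves membership in `S` from `π y` to `π y'`
    have step : ∀ {y y' : V}, OpenAdj ends ω y y' → contractMap W w₀ y ∈ S →
        contractMap W w₀ y' ∈ S := by
      intro y y' hadj hz
      have hyy' : Conn ends ω y y' := conn_of_openAdj hadj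
      by_cases hy : y ∈ W <;> by_cases hy' : y' ∈ W
      · rw [contractMap_of_mem hy']
        rw [contractMap_of_mem hy] at hz
        exact hz
      · rw [contractMap_of_mem hy] at hz
        rw [contractMap_of_notMem hy']
        have hits : ∃ w ∈ W, Conn ends ω s w := by
          rcases hz with hz | ⟨hits, _⟩
          · exact ⟨w₀, hw₀, hz⟩
          · exact hits
        exact Or.inr ⟨hits, y, hy, hyy'⟩
      · rw [contractMap_of_notMem hy] at hz
        rw [contractMap_of_mem hy']
        have hits : ∃ w ∈ W, Conn ends ω s w := by
          rcases hz with hz | ⟨hits, _⟩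
          · exact ⟨y', hy', conn_trans hz hyy'⟩
          · exact hits
        exact Or.inr ⟨hits, w₀, hw₀, conn_refl ends ω w₀⟩
      · rw [contractMap_of_notMem hy] at hz
        rw [contractMap_of_notMem hy']
        rcases hz with hz | ⟨hits, w, hw, hwz⟩
        · exact Or.inl (conn_trans hz hyy')
        · exact Or.inr ⟨hits, w, hw, conn_trans hwz hyy'⟩
    have hS : ∀ z ∈ S, ∀ z', (openGraph (contractEnds ends W w₀) ω).Adj z z' → z' ∈ S := by
      intro z hz z' hzz'
      obtain ⟨_, e, he, hends⟩ := openGraph_adj.1 hzz'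
      obtain ⟨y, y', hyy'⟩ : ∃ y y', ends e = s(y, y') :=
        (Sym2.exists (f := fun x => ends e = x)).1 ⟨ends e, rfl⟩
      rw [contractEnds_apply, hyy', Sym2.map_mk, Sym2.eq_iff] at hends
      rcases hends with ⟨h1, h2⟩ | ⟨h1, h2⟩
      · rw [← h2]
        exact step ⟨e, he, hyy'⟩ (h1 ▸ hz)
      · rw [← h1]
        exact step ⟨e, he, by rw [hyy', Sym2.eq_swap]⟩ (h2 ▸ hz)
    exact mem_of_conn_of_closed hS (Or.inl (conn_refl ends ω s)) h
  · rintro (h | ⟨hs', ht'⟩)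
    · have := conn_contract_of_conn (W := W) (w₀ := w₀) h
      rwa [contractMap_of_notMem hs, contractMap_of_notMem ht] at this
    · have := conn_contract_of_hits (W := W) (w₀ := w₀) hs' ht'
      rwa [contractMap_of_notMem hs, contractMap_of_notMem ht] at this

/-- **The avoidance event of `H/W`** (mine-c §13: `{s ↛_{H/W} T} = R_T ∖ {C(s) hits W ∧ C(T) hits W}`),
for `s ∉ W`, `T ∩ W = ∅`. -/
theorem avoidAll_contract_eq (hw₀ : w₀ ∈ W) {s : V} (hs : s ∉ W) {T : Finset V}
    (hT : ∀ t ∈ T, t ∉ W) :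
    avoidAll (contractEnds ends W w₀) s T =
      avoidAll ends s T ∩
        {ω | ¬ ((∃ w ∈ W, Conn ends ω s w) ∧ ∃ w ∈ W, ∃ t ∈ T, Conn ends ω w t)} := by
  ext ω
  simp only [avoidAll, Set.mem_setOf_eq, Set.mem_inter_iff]
  constructor
  · intro h
    refine ⟨fun t ht hc => h t ht ((conn_contract_iff hw₀ hs (hT t ht)).2 (Or.inl hc)), ?_⟩
    rintro ⟨hsW, w, hw, t, ht, hwt⟩
    exact h t ht ((conn_contract_iff hw₀ hs (hT t ht)).2 (Or.inr ⟨hsW, w, hw, hwt⟩))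
  · rintro ⟨h, hno⟩ t ht hc
    rcases (conn_contract_iff hw₀ hs (hT t ht)).1 hc with hc | ⟨hsW, w, hw, hwt⟩
    · exact h t ht hc
    · exact hno ⟨hsW, w, hw, t, ht, hwt⟩

/-- `s ↛_{H/W} T` implies `s ↮_H T` (`s ∉ W`, `T ∩ W = ∅`). -/
lemma avoidAll_contract_subset (hw₀ : w₀ ∈ W) {s : V} (hs : s ∉ W) {T : Finset V}
    (hT : ∀ t ∈ T, t ∉ W) :
    avoidAll (contractEnds ends W w₀) s T ⊆ avoidAll ends s T := by
  rw [avoidAll_contract_eq hw₀ hs hT]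
  exact Set.inter_subset_left

end Conn

/-! ## The rows -/

section Rows

variable [Fintype E] [DecidableEq E] [DecidableEq V] {R : Type*} [Field R] [LinearOrder R]

variable (p : E → R) (ends : E → Sym2 V) (s : V) (T W : Finset V) (w₀ : V) (a b : V)

/-- **(CON-W)** (mine-c §13), cleared by `P(R_T)²`: with the `H`-events `X = {a ∈ C_H(s)}`,
`Y = {b ∈ C_H(s)}`, the `H`-centring `m = E_H[· | R_T]` and `R′ = {s ↛_{H/W} T}`,
`E_H[(X − m_X)(Y − m_Y); R′] ≥ 0`, i.e.
`P(R_T)² P(XY; R′) − P(R_T) [P(X; R_T) P(Y; R′) + P(Y; R_T) P(X; R′)] + P(X; R_T) P(Y; R_T) P(R′) ≥ 0`. -/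
def ConW : Prop :=
  0 ≤ prob p (avoidAll ends s T) ^ 2 *
        prob p (connAll ends s ({a} ∪ {b}) ∩ avoidAll (contractEnds ends W w₀) s T) -
      prob p (avoidAll ends s T) *
        (prob p (connAll ends s {a} ∩ avoidAll ends s T) *
            prob p (connAll ends s {b} ∩ avoidAll (contractEnds ends W w₀) s T) +
          prob p (connAll ends s {b} ∩ avoidAll ends s T) *
            prob p (connAll ends s {a} ∩ avoidAll (contractEnds ends W w₀) s T)) +
      prob p (connAll ends s {a} ∩ avoidAll ends s T) *
        prob p (connAll ends s {b} ∩ avoidAll ends s T) *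
        prob p (avoidAll (contractEnds ends W w₀) s T)

/-- **(CCT-W)** (mine-c §13): (CON-W) with the merged events `X_{H/W} = {a ∈ C_{H/W}(s)}` in the
`R′`-terms (the `H`-centring kept), cleared by `P(R_T)²`. -/
def CCTW : Prop :=
  0 ≤ prob p (avoidAll ends s T) ^ 2 *
        prob p (connAll (contractEnds ends W w₀) s ({a} ∪ {b}) ∩
          avoidAll (contractEnds ends W w₀) s T) -
      prob p (avoidAll ends s T) *
        (prob p (connAll ends s {a} ∩ avoidAll ends s T) *
            prob p (connAll (contractEnds ends W w₀) s {b} ∩ avoidAll (contractEnds ends W w₀) s T) +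
          prob p (connAll ends s {b} ∩ avoidAll ends s T) *
            prob p (connAll (contractEnds ends W w₀) s {a} ∩
              avoidAll (contractEnds ends W w₀) s T)) +
      prob p (connAll ends s {a} ∩ avoidAll ends s T) *
        prob p (connAll ends s {b} ∩ avoidAll ends s T) *
        prob p (avoidAll (contractEnds ends W w₀) s T)

end Rows

section Closure

variable (R : Type*) [Field R] [LinearOrder R] [IsStrictOrderedRing R]

/-- **Row 2′CON-W**, (CON-W) over all finite graphs, admissible weights, roots `s`, avoided sets
`T`, contracted sets `W ⊆ V ∖ (T ∪ {s})` with representative `w₀ ∈ W`, and markers `a, b`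
(markers may lie in `W`). -/
def ConW_all : Prop :=
  ∀ (V E : Type) [Fintype V] [DecidableEq V] [Fintype E] [DecidableEq E]
    (ends : E → Sym2 V) (p : E → R), IsProbVec p →
    ∀ (s : V) (T W : Finset V) (w₀ a b : V), s ∉ T → s ∉ W → (∀ t ∈ T, t ∉ W) → w₀ ∈ W →
      ConW p ends s T W w₀ a b

/-- **Row 2′CON-W**, (CCT-W) over all finite graphs (same scope). -/
def CCTW_all : Prop :=
  ∀ (V E : Type) [Fintype V] [DecidableEq V] [Fintype E] [DecidableEq E]
    (ends : E → Sym2 V) (p : E → R), IsProbVec p →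
    ∀ (s : V) (T W : Finset V) (w₀ a b : V), s ∉ T → s ∉ W → (∀ t ∈ T, t ∉ W) → w₀ ∈ W →
      CCTW p ends s T W w₀ a b

end Closure

end Contract

end Summit.Ventures.PercRepro2
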